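import Summits.FinalStateConjecture.FinalStateConjecture.Theorems.EIHFluxBalanceInertialRecessionStubSlaving3ZeroSet
import Literature.Geometry.Lorentzian.KerrRadiusGradientVector
import Literature.Geometry.Lorentzian.KerrConvergenceProofs
import Literature.Geometry.Lorentzian.KerrSchildCoord
import Literature.Geometry.Lorentzian.ExtensionProofs
import HarnessLib

/-!
# Crux `ClusterCompleteness.OmegaLimitMultiKerr` (stmt-FinalStateConjecture-17639), line `Sketch` v3 —
# the TIME-DILATED SCHWARZSCHILD form (witness against the stub `stub_noHairUpToGauge` as typed)

Part 1 of 2 (part 2: `…SketchNoHairRefutation`). The crux-strategist's split of the crux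
(`Cruxes/OmegaLimitMultiKerr/DECOMPOSITION.md`; skeleton `Lines/Sketch.lean` v3 = `Lines/split.lean`) cuts
child 2 `TameEraRecurs` at a no-hair statement `stub_noHairUpToGauge` whose conclusion asks for a gauge `θ`
commuting with the UNIT-RATE translations by `Λe₀`. This file builds the witness showing that the
normalisation of the stationary Killing field is missing from its hypotheses: the form
`G(y)(v, w) = g_{1,0}(y)(A v, A w)` on the Schwarzschild exterior `{r > 2}`, where `A = diag(s, 1, 1, 1)`
is a time dilation (`timeDilation_*`: `A w = w + (s − 1) w⁰ e₀`, inverse `B` with `s⁻¹`). Proved here: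

* `G = A^* g_{1,0}` (`dilated_eq_pullMetric`; stationarity `g(x + t e₀) = g(x)` absorbs the base point),
  hence `Ric(G) = 0` on `{r > 0}` (`ricAt_dilated`: `ricAt_pullMetric` + `ricAt_kerr_bilin`, Kerr–Schild
  1965, §3 via `Kerr.ricci_smoothMetric`);
* `G` is nondegenerate and of Lorentzian signature (`isInvertible_dilated`, `dilated_signature`: `A⁻¹V`,
  `V = −g♯dt*`); stationarity and symmetry are read off `Kerr.bilin_add_smul_basisVector_zero` / `Kerr.bilin_symm`;
* `‖G(y) − g_{1,0}(y)‖ ≤ 2|s − 1| ‖g_{1,0}(y)‖` for `0 ≤ s ≤ 1` (`norm_dilated_sub_le`);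
* the inner boundary is null: `dr(G⁻¹dr) = g⁻¹(dr, dr) = 1 − 2/r` (`fderiv_radius_sharpAt_dilated`, from
  `Kerr.bilin_radiusGradVector(_self)`: `g(W, ·) = dr`, `g(W, W) = Δ/Σ`, O'Neill 1995, §2.5).

References: Kerr–Schild 1965, §2–§3; O'Neill 1995, §2.5; O'Neill 1983, Lemma 5.26.
-/

set_option linter.dupNamespace false
set_option maxSynthPendingDepth 3

noncomputable section

open scoped Topology Manifold ContDiff
open Filter Set Function TopologicalSpace Literature.Geometry.Lorentzian
open Summit.FinalStateConjecture.FinalStateConjecture.Theorems.SublinearIsFree.Slaving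
  (ricAt_pullMetric ricAt_kerr_bilin isMetricOn_kerr_bilin)

namespace Summit.FinalStateConjecture.FinalStateConjecture.Theorems.ClusterCompleteness

/-! ### Elementary facts on `E4` -/

/-- `g_{M,a}(e₀, e₀) = −1 + 2H` (`ℓ(e₀) = 1`, `η(e₀, e₀) = −1`). Kerr–Schild 1965, §2. [cite: KerrSchild1965, §2] -/
theorem kerr_bilin_basisVector_zero :
    ∀ (M a : ℝ) (x : E4), Kerr.bilin M a x (E4.basisVector 0) (E4.basisVector 0) = -1 + 2 * Kerr.scalarH M a x := by
  intro M a x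
  rw [Kerr.bilin_apply, Minkowski.bilin_basisVector_zero, Kerr.nullCovector_basisVector_zero]
  ring

/-! ### The time dilation `A = diag(s, 1, 1, 1)` and its inverse -/

section TimeDilation

variable {s : ℝ} {A B : E4 →L[ℝ] E4}
  (hA : ∀ w : E4, A w = w + ((s - 1) * w 0) • E4.basisVector 0)
  (hB : ∀ w : E4, B w = w + ((s⁻¹ - 1) * w 0) • E4.basisVector 0)

include hA in
/-- `(A w)⁰ = s w⁰`. [folklore] -/
theorem timeDilation_apply_zero (w : E4) : A w 0 = s * w 0 := by
  rw [hA w, PiLp.add_apply, PiLp.smul_apply, show (E4.basisVector 0 : E4) 0 = 1 by simp [E4.basisVector]]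
  simp only [smul_eq_mul, mul_one]
  ring

include hA in
/-- `A` does not change the spatial part. [folklore] -/
theorem spatial_timeDilation (w : E4) : E4.spatial (A w) = E4.spatial w := by
  rw [hA w, map_add, map_smul, E4.spatial_basisVector_zero, smul_zero, add_zero]

include hA in
/-- `A e₀ = s e₀`. [folklore] -/
theorem timeDilation_basisVector_zero : A (E4.basisVector 0) = s • E4.basisVector 0 := by
  rw [hA, show (E4.basisVector 0 : E4) 0 = 1 by simp [E4.basisVector], mul_one]
  calc E4.basisVector 0 + (s - 1) • E4.basisVector 0
      = (1 + (s - 1)) • E4.basisVector 0 := by rw [add_smul, one_smul]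
    _ = s • E4.basisVector 0 := by congr 1; ring

include hA hB in
/-- `A (B w) = w` for `s ≠ 0`. [folklore] -/
theorem timeDilation_inverse_apply (hs : s ≠ 0) (w : E4) : A (B w) = w := by
  have hB0 : B w 0 = s⁻¹ * w 0 := by
    rw [hB w, PiLp.add_apply, PiLp.smul_apply, show (E4.basisVector 0 : E4) 0 = 1 by simp [E4.basisVector]]
    simp only [smul_eq_mul, mul_one]
    ring
  rw [hA (B w), hB0, hB w, add_assoc, ← add_smul]
  have : (s⁻¹ - 1) * w 0 + (s - 1) * (s⁻¹ * w 0) = 0 := by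
    field_simp
    ring
  rw [this, zero_smul, add_zero]

include hA hB in
/-- `B (A w) = w` for `s ≠ 0`. [folklore] -/
theorem inverse_timeDilation_apply (hs : s ≠ 0) (w : E4) : B (A w) = w := by
  have hA0 : A w 0 = s * w 0 := timeDilation_apply_zero hA w
  rw [hB (A w), hA0, hA w, add_assoc, ← add_smul]
  have : (s - 1) * w 0 + (s⁻¹ - 1) * (s * w 0) = 0 := by
    field_simp
    ring
  rw [this, zero_smul, add_zero]

include hA hB in
/-- `A` is invertible for `s ≠ 0`. [folklore] -/
theorem isInvertible_timeDilation (hs : s ≠ 0) : A.IsInvertible :=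
  ⟨ContinuousLinearEquiv.equivOfInverse A B (inverse_timeDilation_apply hA hB hs)
    (timeDilation_inverse_apply hA hB hs), rfl⟩

include hA in
/-- `‖A w‖ ≤ ‖w‖` for `0 ≤ s ≤ 1`. [folklore] -/
theorem norm_timeDilation_le (hs0 : 0 ≤ s) (hs1 : s ≤ 1) (w : E4) : ‖A w‖ ≤ ‖w‖ := by
  have h1 : ‖A w‖ ^ 2 = (s * w 0) ^ 2 + E4.spatialNorm w ^ 2 := by
    rw [norm_sq_eq_sq_add_spatialNorm_sq (A w), timeDilation_apply_zero hA w, E4.spatialNorm,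
      E4.spatialNorm, spatial_timeDilation hA w]
  have h2 : ‖w‖ ^ 2 = w 0 ^ 2 + E4.spatialNorm w ^ 2 := norm_sq_eq_sq_add_spatialNorm_sq w
  have h3 : (s * w 0) ^ 2 ≤ w 0 ^ 2 := by
    rw [mul_pow]
    have : s ^ 2 ≤ 1 := by nlinarith
    nlinarith [sq_nonneg (w 0)]
  exact le_of_pow_le_pow_left₀ two_ne_zero (norm_nonneg _) (by linarith)

include hA in
/-- `‖A w − w‖ ≤ |s − 1| ‖w‖`. [folklore] -/
theorem norm_timeDilation_sub_le (w : E4) : ‖A w - w‖ ≤ |s - 1| * ‖w‖ := by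
  rw [hA w, add_sub_cancel_left, norm_smul, PiLp.norm_single, norm_one, mul_one,
    Real.norm_eq_abs, abs_mul]
  exact mul_le_mul_of_nonneg_left (C0Extension.abs_apply_zero_le_norm w) (abs_nonneg _)

include hA in
/-- Stationarity of the Kerr–Schild form makes it blind to `A`: `g_{M,a}(A y) = g_{M,a}(y)`.
Kerr–Schild 1965, §2. [cite: KerrSchild1965, §2] -/
theorem kerr_bilin_timeDilation (M a : ℝ) (y : E4) : Kerr.bilin M a (A y) = Kerr.bilin M a y := by
  rw [hA y]
  exact Kerr.bilin_add_smul_basisVector_zero M a y _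

include hA in
/-- The Kerr–Schild radius is blind to `A`. [folklore] -/
theorem radius_timeDilation (a : ℝ) (y : E4) : Kerr.radius a (A y) = Kerr.radius a y :=
  Kerr.radius_eq_of_spatial_eq a (spatial_timeDilation hA y)

end TimeDilation

/-! ### The dilated Schwarzschild form `G(y)(v, w) = g_{1,0}(y)(A v, A w)` -/

section Dilated

variable {s : ℝ} {A B : E4 →L[ℝ] E4}
  (hA : ∀ w : E4, A w = w + ((s - 1) * w 0) • E4.basisVector 0)
  (hB : ∀ w : E4, B w = w + ((s⁻¹ - 1) * w 0) • E4.basisVector 0)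
  {G : E4 → E4 →L[ℝ] E4 →L[ℝ] ℝ} (hG : ∀ y v w, G y v w = Kerr.bilin 1 0 y (A v) (A w))

include hA hG in
/-- `G` is the pull-back of `g_{1,0}` by the linear change of coordinates `A` (stationarity absorbs the
shift of the base point). [folklore] -/
theorem dilated_eq_pullMetric : G = MetricCoord.pullMetric (Kerr.bilin 1 0) A := by
  funext y
  ext v w
  rw [MetricCoord.pullMetric_apply, ContinuousLinearMap.fderiv, hG, kerr_bilin_timeDilation hA]

include hA hB hG in
/-- `G(y)` is nondegenerate, hence invertible, wherever `r > 0` (`s ≠ 0`). [folklore] -/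
theorem isInvertible_dilated (hs : s ≠ 0) {y : E4} (hy : 0 < Kerr.radius 0 y) : (G y).IsInvertible := by
  refine MetricCoord.isInvertible_of_nondegenerate fun v hv ↦ ?_
  have hAv : A v = 0 := by
    refine Kerr.bilin_nondegenerate 1 0 hy (A v) fun u ↦ ?_
    have := hv (B u)
    rwa [hG, timeDilation_inverse_apply hA hB hs] at this
  have := inverse_timeDilation_apply hA hB hs v
  rw [hAv, map_zero] at this
  exact this.symm

include hA hB hG in
/-- `G(y)` has Lorentzian signature wherever `r > 0`: `v = A⁻¹ V`, `V = −g♯dt*`, is timelike and its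
`G`-orthogonal complement is spacelike. Kerr–Schild 1965, §2; O'Neill 1983, Lemma 5.26. [cite: KerrSchild1965, §2] -/
theorem dilated_signature (hs : s ≠ 0) {y : E4} (hy : 0 < Kerr.radius 0 y) :
    ∃ v : E4, G y v v < 0 ∧ ∀ w : E4, G y v w = 0 → w ≠ 0 → 0 < G y w w := by
  refine ⟨B (Kerr.timeVector 1 0 y), ?_, fun w hw hw0 ↦ ?_⟩
  · rw [hG, timeDilation_inverse_apply hA hB hs]
    exact Kerr.bilin_timeVector_timeVector_neg zero_le_one 0 hy
  · rw [hG, timeDilation_inverse_apply hA hB hs] at hw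
    rw [hG]
    refine Kerr.bilin_pos_of_orthogonal 1 0 hy _ _ (Kerr.bilin_timeVector_timeVector_neg zero_le_one 0 hy)
      hw fun h ↦ hw0 ?_
    have := inverse_timeDilation_apply hA hB hs w
    rw [h, map_zero] at this
    exact this.symm

include hA hB hG in
/-- `G` is Ricci-flat wherever `r > 0`: it is the pull-back of the Ricci-flat `g_{1,0}` by the change of
coordinates `A` (`ricAt_pullMetric`, `ricAt_kerr_bilin`). Kerr–Schild 1965, §3. [cite: KerrSchild1965, §3] -/
theorem ricAt_dilated (hs : s ≠ 0) {y : E4} (hy : 0 < Kerr.radius 0 y) : MetricCoord.ricAt G y = 0 := by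
  have hcc : MetricCoord.IsCoordChangeOn A (A ⁻¹' (Kerr.region 0 0 : Set E4)) (Kerr.region 0 0 : Set E4) :=
    { isOpen := (Kerr.region 0 0).isOpen.preimage A.continuous
      contDiffOn := A.contDiff.contDiffOn
      mapsTo := fun _ hx ↦ hx
      isInvertible := fun x _ ↦ by
        rw [ContinuousLinearMap.fderiv]
        exact isInvertible_timeDilation hA hB hs }
  have hy' : y ∈ A ⁻¹' (Kerr.region 0 0 : Set E4) := by
    show A y ∈ (Kerr.region 0 0 : Set E4)
    rw [SetLike.mem_coe, Kerr.mem_region, max_self, radius_timeDilation hA]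
    exact hy
  have hAy : 0 < Kerr.radius 0 (A y) := by rw [radius_timeDilation hA]; exact hy
  ext Y Z
  rw [dilated_eq_pullMetric hA hG, ricAt_pullMetric (isMetricOn_kerr_bilin 1 0) hcc hy' Y Z,
    ricAt_kerr_bilin 1 0 hAy]
  rfl

include hA hG in
/-- `C⁰`-closeness: `‖G(y) − g_{1,0}(y)‖ ≤ 2 |s − 1| ‖g_{1,0}(y)‖` for `0 ≤ s ≤ 1`. [folklore] -/
theorem norm_dilated_sub_le (hs0 : 0 ≤ s) (hs1 : s ≤ 1) (y : E4) :
    ‖G y - Kerr.bilin 1 0 y‖ ≤ 2 * |s - 1| * ‖Kerr.bilin 1 0 y‖ := by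
  refine ContinuousLinearMap.opNorm_le_bound₂ _ (by positivity) fun v w ↦ ?_
  rw [sub_apply, sub_apply, hG, Real.norm_eq_abs]
  set g := Kerr.bilin 1 0 y
  have h1 : g (A v) (A w) - g v w = g (A v - v) (A w) + g v (A w - w) := by
    simp only [map_sub, sub_apply]
    ring
  rw [h1]
  have e1 : |g (A v - v) (A w)| ≤ ‖g‖ * (|s - 1| * ‖v‖) * ‖w‖ := by
    refine (Real.norm_eq_abs _ ▸ g.le_opNorm₂ (A v - v) (A w)).trans ?_
    gcongr
    · exact norm_timeDilation_sub_le hA v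
    · exact norm_timeDilation_le hA hs0 hs1 w
  have e2 : |g v (A w - w)| ≤ ‖g‖ * ‖v‖ * (|s - 1| * ‖w‖) := by
    refine (Real.norm_eq_abs _ ▸ g.le_opNorm₂ v (A w - w)).trans ?_
    gcongr
    exact norm_timeDilation_sub_le hA w
  calc |g (A v - v) (A w) + g v (A w - w)|
      ≤ |g (A v - v) (A w)| + |g v (A w - w)| := abs_add_le _ _
    _ ≤ ‖g‖ * (|s - 1| * ‖v‖) * ‖w‖ + ‖g‖ * ‖v‖ * (|s - 1| * ‖w‖) := add_le_add e1 e2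
    _ = 2 * |s - 1| * ‖g‖ * ‖v‖ * ‖w‖ := by ring

include hA hB hG in
/-- The inner boundary `{r = 2}` is null for `G`: `dr(G⁻¹ dr) = g⁻¹(dr, dr) = 1 − 2/r` on `{r > 0}`
(`G⁻¹ dr = A⁻¹ W`, `W = g⁻¹ dr = Kerr.radiusGradVector`, and `dr` is blind to `A`). O'Neill 1995, §2.5.
[cite: ONeill1995, §2.5] -/
theorem fderiv_radius_sharpAt_dilated (hs : s ≠ 0) {y : E4} (hy : 0 < Kerr.radius 0 y) :
    fderiv ℝ (Kerr.radius 0) y (MetricCoord.sharpAt G y (fderiv ℝ (Kerr.radius 0) y)) =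
      1 - 2 / Kerr.radius 0 y := by
  have hd : fderiv ℝ (Kerr.radius 0) y = (Kerr.radiusGrad 0 (E4.spatial y)).comp E4.spatial :=
    (Kerr.hasFDerivAt_radius hy).fderiv
  have hsharp : MetricCoord.sharpAt G y (fderiv ℝ (Kerr.radius 0) y) = B (Kerr.radiusGradVector 1 0 y) := by
    refine MetricCoord.sharpAt_eq_of_forall (isInvertible_dilated hA hB hG hs hy) fun w ↦ ?_
    rw [hG, timeDilation_inverse_apply hA hB hs, Kerr.bilin_radiusGradVector hy, hd,
      ContinuousLinearMap.comp_apply, spatial_timeDilation hA]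
  rw [hsharp, hd, ContinuousLinearMap.comp_apply]
  have hsp : E4.spatial (B (Kerr.radiusGradVector 1 0 y)) = E4.spatial (Kerr.radiusGradVector 1 0 y) := by
    rw [hB, map_add, map_smul, E4.spatial_basisVector_zero, smul_zero, add_zero]
  rw [hsp, ← Kerr.bilin_radiusGradVector hy, Kerr.bilin_radiusGradVector_self hy]
  -- `a = 0`: `Σ = r²`, `r = ‖y⃗‖`
  have hr : Kerr.radius 0 (E4.ofTimeSpace 0 (E4.spatial y)) = Kerr.radius 0 y := by
    rw [Kerr.radius_ofTimeSpace_spatial]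
  have hSig : Kerr.blSigma 0 (E4.spatial y) = Kerr.radius 0 y ^ 2 := by
    rw [Kerr.blSigma, hr, Kerr.radius_zero_left, E4.spatialNorm]
    ring
  rw [hSig]
  have hr0 : Kerr.radius 0 y ≠ 0 := hy.ne'
  field_simp
  ring

end Dilated

end Summit.FinalStateConjecture.FinalStateConjecture.Theorems.ClusterCompleteness

end
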